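import Summits.Ventures.HodgeRepro2.T5InertTopCoefficientMatrix
import Summits.Ventures.HodgeRepro2.T5HeckePolynomialAlgebra

/-!
# The top coefficient of `T₁ · Tₙ` is `1`: the Satake «algebra half» with no hypothesis left
(cell pub-hodge-repro2, seat p3)

Tier-5 N3 support. Seat p8's T5-187 `aeval_bijective_of_top_coeff` and T5-180
`heckeAlgebra_nonempty_algEquiv_polynomial` state `H(U(antidiag(1, u, 1)), K) = k[T₁]` modulo the top
coefficient `c_{n+1} = 1` of `T₁ · Tₙ` (T5-187's `htop`; the leading-term property `hlead` of T5-180), which p8's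
T5-5x expresses as the coset count `#{x K ⊆ K aₙ K : x⁻¹ a_{n+1} ∈ K a₁ K}` (`coeff_doubleCosetOp_mul_apply_single_one`).
Here the count is `1`: the only such coset is `aₙ K` itself —
* `cellU_inv_mul_succ` — `aₙ⁻¹ a_{n+1} = a₁` in `U(J₃(u))` (file 186's cell algebra), so `aₙ K` qualifies;
* **`orbit_inter_eq_singleton`** — conversely, `x = κ aₙ K` with `x⁻¹ a_{n+1} ∈ K a₁ K` forces `ϖ` to clear
  `aₙ⁻¹ κ⁻¹ a_{n+1}` (p8's `clears_pow_of_mem_orbit_cellU`), hence `aₙ⁻¹ κ⁻¹ aₙ` is integral (file 186's matrix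
  lemma) and unitary, hence in `K` (p8's T5-123b `mem_range_of_entries`), i.e. `κ aₙ K = aₙ K`;
* **`top_coeff_eq_one`** — `htop` for every `n`;
* **`aeval_bijective`**, `mul_sub_mem_span` (`hlead`), **`nonempty_algEquiv_polynomial`** — `k[X] ≃ₐ[k] H(U, K)`
  under p8's standing hypotheses only (R a DVR with finite residue field, the star preserving R, `u` a star-fixed
  unit, `ϖ` a star-fixed uniformiser): THE SATAKE ALGEBRA HALF OF THE INERT-PLACE PACKAGE HAS NO HYPOTHESIS LEFT.

Mathlib + this seat's file 186 + seat p8's T5-5x / T5-136 / T5-180 / T5-187 and their imports; no display; no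
device. §8(d): uses an L-value-free non-vanishing device: NO.
-/

namespace Summit.Ventures.HodgeRepro2.T5InertTopCoefficient

open Summit.Ventures.HodgeRepro2.T5CartanCellsDistinct Summit.Ventures.HodgeRepro2.T5HeckeBasisCells
  Summit.Ventures.HodgeRepro2.T5HermitianThreeElements Summit.Ventures.HodgeRepro2.T5UnitaryGroupForm
  Summit.Ventures.HodgeRepro2.T5UnitaryThreeCorner Summit.Ventures.HodgeRepro2.T5UnitaryHeckeAdjoint
  Summit.Ventures.HodgeRepro2.T5HeckeDoubleCoset Summit.Ventures.HodgeRepro2.T5HeckeConvolution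
  Summit.Ventures.HodgeRepro2.T5HeckePermutationModule Summit.Ventures.HodgeRepro2.T5HeckeCellFiltration
  Summit.Ventures.HodgeRepro2.T5HeckePolynomialAlgebra Summit.Ventures.HodgeRepro2.T5InertTopCoefficientMatrix

/-! ## The coset count -/

section Count

variable {R E : Type*} [CommRing R] [Field E] [StarRing E] [Algebra R E] [IsFractionRing R E]
  (u : E) {ϖ : R} (hϖ : Irreducible ϖ) (hs : star (algebraMap R E ϖ) = algebraMap R E ϖ)

/-- The cell `aₙ ∈ U(J₃(u))` as an element of `GL₃(E)` is p8's `cell hϖ n`. -/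
theorem coe_cellU (n : ℕ) :
    ((cellU hϖ hs u n : formUnitaryGroup (J3 u)) : GL (Fin 3) E) = cell hϖ n := rfl

/-- `aₙ⁻¹ · a_{n+1} = a₁` in `U(J₃(u))`. -/
theorem cellU_inv_mul_succ (n : ℕ) :
    (cellU hϖ hs u n)⁻¹ * cellU hϖ hs u (n + 1) = cellU hϖ hs u 1 := by
  apply Subtype.ext
  simp only [Subgroup.coe_mul, Subgroup.coe_inv, coe_cellU]
  exact inv_cell_mul_cell_succ hϖ n

variable [IsDomain R] [IsDiscreteValuationRing R]
  (hstar : ∀ x : E, IsLocalization.IsInteger R x → IsLocalization.IsInteger R (star x))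
  (hu0 : u ≠ 0) (hu : IsLocalization.IsInteger R u) (hu' : IsLocalization.IsInteger R u⁻¹)

include hstar hu0 hu hu' in
/-- **The coset count.** The cosets `x K ⊆ K aₙ K` with `x⁻¹ a_{n+1} ∈ K a₁ K` form the singleton `{aₙ K}`. -/
theorem orbit_inter_eq_singleton (n : ℕ) :
    MulAction.orbit (hyperspecialSubgroup R (J3 u))
        ((cellU hϖ hs u n : formUnitaryGroup (J3 u)) :
          formUnitaryGroup (J3 u) ⧸ hyperspecialSubgroup R (J3 u)) ∩
      {x | ((Quotient.out x)⁻¹ • ((cellU hϖ hs u (n + 1) : formUnitaryGroup (J3 u)) :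
            formUnitaryGroup (J3 u) ⧸ hyperspecialSubgroup R (J3 u)) :
            formUnitaryGroup (J3 u) ⧸ hyperspecialSubgroup R (J3 u)) ∈
        MulAction.orbit (hyperspecialSubgroup R (J3 u))
          ((cellU hϖ hs u 1 : formUnitaryGroup (J3 u)) :
            formUnitaryGroup (J3 u) ⧸ hyperspecialSubgroup R (J3 u))} =
    {((cellU hϖ hs u n : formUnitaryGroup (J3 u)) :
      formUnitaryGroup (J3 u) ⧸ hyperspecialSubgroup R (J3 u))} := by
  set K := hyperspecialSubgroup R (J3 u) with hK
  rw [Set.eq_singleton_iff_unique_mem]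
  constructor
  · refine ⟨MulAction.mem_orbit_self _, ?_⟩
    obtain ⟨h, hh⟩ := QuotientGroup.mk_out_eq_mul K (cellU hϖ hs u n)
    show ((Quotient.out ((cellU hϖ hs u n : formUnitaryGroup (J3 u)) :
        formUnitaryGroup (J3 u) ⧸ K))⁻¹ • ((cellU hϖ hs u (n + 1) : formUnitaryGroup (J3 u)) :
        formUnitaryGroup (J3 u) ⧸ K) : formUnitaryGroup (J3 u) ⧸ K) ∈
      MulAction.orbit K ((cellU hϖ hs u 1 : formUnitaryGroup (J3 u)) : formUnitaryGroup (J3 u) ⧸ K)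
    rw [hh, MulAction.Quotient.smul_mk, smul_eq_mul, _root_.mul_inv_rev, mul_assoc, cellU_inv_mul_succ]
    exact MulAction.mem_orbit_iff.2 ⟨h⁻¹, rfl⟩
  · rintro x ⟨hx1, hx2⟩
    obtain ⟨κ, rfl⟩ := MulAction.mem_orbit_iff.1 hx1
    -- `x = κ aₙ K`; write `out x = κ aₙ h'`
    obtain ⟨h', hh'⟩ := QuotientGroup.mk_out_eq_mul K ((κ : formUnitaryGroup (J3 u)) * cellU hϖ hs u n)
    have hx2' : ((((κ : formUnitaryGroup (J3 u)) * cellU hϖ hs u n * h')⁻¹ * cellU hϖ hs u (n + 1) :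
        formUnitaryGroup (J3 u)) : formUnitaryGroup (J3 u) ⧸ K) ∈
        MulAction.orbit K ((cellU hϖ hs u 1 : formUnitaryGroup (J3 u)) : formUnitaryGroup (J3 u) ⧸ K) := by
      have := hx2
      simp only [Set.mem_setOf_eq] at this
      change ((Quotient.out ((((κ : formUnitaryGroup (J3 u)) * cellU hϖ hs u n : formUnitaryGroup (J3 u)) :
        formUnitaryGroup (J3 u) ⧸ K)))⁻¹ • ((cellU hϖ hs u (n + 1) : formUnitaryGroup (J3 u)) :
        formUnitaryGroup (J3 u) ⧸ K) : formUnitaryGroup (J3 u) ⧸ K) ∈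
        MulAction.orbit K ((cellU hϖ hs u 1 : formUnitaryGroup (J3 u)) : formUnitaryGroup (J3 u) ⧸ K) at this
      rwa [hh', MulAction.Quotient.smul_mk, smul_eq_mul] at this
    -- `ϖ` clears the matrix of `(κ aₙ h')⁻¹ a_{n+1} = h'⁻¹ · (aₙ⁻¹ κ⁻¹ a_{n+1})`
    have hcl := clears_pow_of_mem_orbit_cellU u hϖ hs hx2'
    have hrew : ((κ : formUnitaryGroup (J3 u)) * cellU hϖ hs u n * h')⁻¹ * cellU hϖ hs u (n + 1) =
        ((h' : formUnitaryGroup (J3 u)))⁻¹ *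
          ((cellU hϖ hs u n)⁻¹ * (κ : formUnitaryGroup (J3 u))⁻¹ * cellU hϖ hs u (n + 1)) := by
      simp only [_root_.mul_inv_rev, mul_assoc]
    rw [hrew, Nat.cast_one, zpow_one, Subgroup.coe_mul, Units.val_mul] at hcl
    have hh'K : ((h' : formUnitaryGroup (J3 u)) : GL (Fin 3) E) ∈
        (Matrix.GeneralLinearGroup.map (algebraMap R E)).range :=
      (mem_hyperspecialSubgroup_iff R _).1 h'.2
    have hκ : ((κ : formUnitaryGroup (J3 u)) : GL (Fin 3) E) ∈
        (Matrix.GeneralLinearGroup.map (algebraMap R E)).range :=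
      (mem_hyperspecialSubgroup_iff R _).1 κ.2
    have hcl' : Clears R (algebraMap R E ϖ)
        (((((cellU hϖ hs u n)⁻¹ * (κ : formUnitaryGroup (J3 u))⁻¹ * cellU hϖ hs u (n + 1) :
          formUnitaryGroup (J3 u)) : GL (Fin 3) E) : Matrix (Fin 3) (Fin 3) E)) := by
      rw [Subgroup.coe_inv] at hcl
      exact (clears_mul_left_iff _ _ (Subgroup.inv_mem _ hh'K)).1 hcl
    have hcl'' : Clears R (algebraMap R E ϖ)
        ((((cell hϖ n : GL (Fin 3) E)⁻¹ : GL (Fin 3) E) : Matrix (Fin 3) (Fin 3) E) *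
          ((((κ : formUnitaryGroup (J3 u)) : GL (Fin 3) E)⁻¹ : GL (Fin 3) E) : Matrix (Fin 3) (Fin 3) E) *
          ((cell hϖ (n + 1) : GL (Fin 3) E) : Matrix (Fin 3) (Fin 3) E)) := by
      simpa only [Subgroup.coe_mul, Subgroup.coe_inv, Units.val_mul, coe_cellU] using hcl'
    -- file 186: `aₙ⁻¹ κ⁻¹ aₙ` is integral
    have hint := isInteger_conj_cell_of_clears hstar hu hϖ hs n
      (m := ((((κ : formUnitaryGroup (J3 u)) : GL (Fin 3) E)⁻¹ : GL (Fin 3) E) : Matrix (Fin 3) (Fin 3) E))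
      (T5CartanCellsDistinct.isInteger_apply_of_mem_range (Subgroup.inv_mem _ hκ))
      (mem_formUnitaryGroup_iff.1 (Subgroup.inv_mem _ (κ : formUnitaryGroup (J3 u)).2)) hcl''
    -- hence `aₙ⁻¹ κ⁻¹ aₙ ∈ K`, i.e. `κ aₙ K = aₙ K`
    have hg₀K : (cellU hϖ hs u n)⁻¹ * (κ : formUnitaryGroup (J3 u))⁻¹ * cellU hϖ hs u n ∈ K := by
      refine (mem_hyperspecialSubgroup_iff R _).2 ?_
      refine mem_range_of_entries hstar u hu0 hu hu' _
        ((cellU hϖ hs u n)⁻¹ * (κ : formUnitaryGroup (J3 u))⁻¹ * cellU hϖ hs u n).2 fun i j => ?_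
      have := hint i j
      simpa only [Subgroup.coe_mul, Subgroup.coe_inv, Units.val_mul, coe_cellU] using this
    show (((κ : formUnitaryGroup (J3 u)) * cellU hϖ hs u n : formUnitaryGroup (J3 u)) :
        formUnitaryGroup (J3 u) ⧸ K) = ((cellU hϖ hs u n : formUnitaryGroup (J3 u)) : formUnitaryGroup (J3 u) ⧸ K)
    refine (QuotientGroup.eq).2 ?_
    rw [_root_.mul_inv_rev]
    exact hg₀K

end Count

/-! ## The Satake algebra half -/

section Satake

variable {R E : Type*} [CommRing R] [Field E] [StarRing E] [Algebra R E] [IsFractionRing R E] [IsDomain R]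
  [IsDiscreteValuationRing R] [Finite (IsLocalRing.ResidueField R)]
  (hstar : ∀ x : E, IsLocalization.IsInteger R x → IsLocalization.IsInteger R (star x))
  (u : E) (hsu : star u = u) (hu0 : u ≠ 0) (hu : IsLocalization.IsInteger R u)
  (hu' : IsLocalization.IsInteger R u⁻¹) {ϖ : R} (hϖ : Irreducible ϖ)
  (hs : star (algebraMap R E ϖ) = algebraMap R E ϖ)

include hstar hu0 hu hu' in
/-- **The top coefficient is `1`**: p8's T5-187 hypothesis `htop`, for every `n`. -/
theorem top_coeff_eq_one (k : Type*) [Field k] (n : ℕ) :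
    (((doubleCosetOp k (hyperspecialSubgroup R (J3 u)) (cellU hϖ hs u 1) *
        doubleCosetOp k (hyperspecialSubgroup R (J3 u)) (cellU hϖ hs u n) :
        heckeAlgebra k (hyperspecialSubgroup R (J3 u))) :
        Module.End k (MonoidAlgebra k (formUnitaryGroup (J3 u) ⧸ hyperspecialSubgroup R (J3 u))))
      (MonoidAlgebra.single ((1 : formUnitaryGroup (J3 u)) :
        formUnitaryGroup (J3 u) ⧸ hyperspecialSubgroup R (J3 u)) 1)).coeff
      ((cellU hϖ hs u (n + 1) : formUnitaryGroup (J3 u)) :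
        formUnitaryGroup (J3 u) ⧸ hyperspecialSubgroup R (J3 u)) = 1 := by
  rw [coeff_doubleCosetOp_mul_apply_single_one, orbit_inter_eq_singleton u hϖ hs hstar hu0 hu hu' n,
    Set.ncard_singleton, Nat.cast_one]

include hstar hsu hu0 hu hu' in
/-- **`H(U(J₃(u)), K) = k[T₁]`**: evaluation at `T₁` is a bijection `k[X] → H(U, K)` (p8's T5-187 with `htop`
discharged). -/
theorem aeval_bijective (k : Type*) [Field k] :
    Function.Bijective (Polynomial.aeval (R := k) (heckeBasisCells hstar u hsu hu0 hu hu' hϖ hs k 1)) :=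
  aeval_bijective_of_top_coeff hstar u hsu hu0 hu hu' hϖ hs k (top_coeff_eq_one hstar u hu0 hu hu' hϖ hs k)

include hstar hsu hu0 hu hu' in
/-- **The leading-term property `hlead`** of p8's T5-180: `T₁ · Tₙ − T_{n+1}` lies in the span of `T₀, …, Tₙ`. -/
theorem mul_sub_mem_span (k : Type*) [Field k] (n : ℕ) :
    heckeBasisCells hstar u hsu hu0 hu hu' hϖ hs k 1 * heckeBasisCells hstar u hsu hu0 hu hu' hϖ hs k n -
        heckeBasisCells hstar u hsu hu0 hu hu' hϖ hs k (n + 1) ∈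
      Submodule.span k (heckeBasisCells hstar u hsu hu0 hu hu' hϖ hs k '' {i | i < n + 1}) := by
  have h := mul_cellU_eq_sum hstar u hsu hu0 hu hu' hϖ hs k 1 n
  rw [Finset.sum_range_succ, top_coeff_eq_one hstar u hu0 hu hu' hϖ hs k n, one_smul] at h
  rw [h]
  abel_nf
  refine Submodule.sum_mem _ fun m hm => Submodule.smul_mem _ _ (Submodule.subset_span ⟨m, ?_, rfl⟩)
  simpa only [Set.mem_setOf_eq, Finset.mem_range] using hm

include hstar hsu hu0 hu hu' hϖ hs in
/-- **The Satake algebra half with no hypothesis left**: `k[X] ≃ₐ[k] H(U(J₃(u)), K)` (p8's T5-180 with `hlead`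
discharged). -/
theorem nonempty_algEquiv_polynomial (k : Type*) [Field k] :
    Nonempty (Polynomial k ≃ₐ[k] heckeAlgebra k (hyperspecialSubgroup R (J3 u))) :=
  heckeAlgebra_nonempty_algEquiv_polynomial hstar u hsu hu0 hu hu' hϖ hs k
    (mul_sub_mem_span hstar u hsu hu0 hu hu' hϖ hs k)

end Satake

end Summit.Ventures.HodgeRepro2.T5InertTopCoefficient
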